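import Mathlib
import Literature.NumberTheory.LFunctions.TaoLogChowla
import Summits.QuantumAdvantage.QuantumAdvantage.Theorems.MobiusLadderQuadraticDigitPhasesStubHi
import Summits.QuantumAdvantage.QuantumAdvantage.Theorems.MobiusLadderQuadraticDigitPhasesStubCompactLemmas2

/-!
# `QuadraticDigitPhases` (stmt-QuantumAdvantage-1391) — line `Sketch`, stub `stub_momoKatai`

Crux `Summit.QuantumAdvantage.QuantumAdvantage.Theses.MobiusLadder.QuadraticDigitPhases`, line `Sketch`
(lead skeleton `work/QuadraticDigitPhases.lean`), banded branch. We prove that the DYADIC BLOCK STATISTIC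

  `BS(k,n) := Σ_{b < 2^{n-k}} ‖Σ_{a < 2^k} λ(2^k b + a) f(2^k b + a)‖`

is `o(2^n)` (`k → ∞` first, then `n → ∞`) for a `1`-bounded `f : ℕ → ℂ` whose odd-prime-pair
correlations `g(m) = f(p₁ m) conj f(p₂ m)` have uniformly small sums on the aligned blocks
`[a 2^l, (a+1) 2^l)` once `l` is large, GIVEN the Bourgain–Sarnak–Ziegler criterion at a fixed length
(`hBSZ`, the neighbour stub `stub_bszFixedN`, here a hypothesis).

Proof (duality). With `H = 2^k`, `S_b = Σ_{a<H} λ(Hb+a) f(Hb+a)` and the unimodular-or-zero signs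
`σ(b) = conj(S_b)/‖S_b‖`, one has `BS = Σ_b σ(b) S_b = Σ_{1 ≤ m ≤ 2^n-1} λ(m) F(m)` with the `1`-bounded
`F(m) = σ(⌊m/H⌋) f(m)` (`duality`). BSZ at `N = 2^n - 1` bounds this by `2√(τ log(1/τ)) N ≤ ε 2^n`
provided the pair sums `Σ_{m ≤ M} F(p₁m) conj F(p₂m)`, `M = ⌊N / max(p₁,p₂)⌋`, are `≤ τ M` for the primes
`p₁ ≠ p₂ ∈ (1/τ, e^{1/τ}]` (odd, `≤ B = ⌈e^{1/τ}⌉`). Cutting `[0, M]` into aligned blocks of length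
`L = 2^l`, `l = k - c` with `2^c ≥ 8B/τ`: on a block where both `m ↦ ⌊p_i m/H⌋` are constant the
`σ`-weight is a constant of norm `≤ 1` and the block hypothesis gives `≤ δ L`; the other blocks are
counted by the total jump `(p₁+p₂) M/H` of these monotone maps (`norm_block_le`, `norm_sum_blocks_le`),
so `‖pair sum‖ ≤ 2δ(M+1) + L + 1 ≤ τ M` for `δ = τ/4` and `n` large (`norm_pair_le`).
-/

set_option linter.dupNamespace false -- D-0017: single-problem summit ⇒ `QuantumAdvantage.QuantumAdvantage` by design

namespace Summit.QuantumAdvantage.QuantumAdvantage.Theorems.MobiusLadderQuadraticDigitPhasesStubMomoKatai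

open Finset Filter
open Literature.NumberTheory.LFunctions (isMultiplicative_liouville_complex norm_liouville_complex_le_one)
open Summit.QuantumAdvantage.QuantumAdvantage.Theorems.MobiusLadderQuadraticDigitPhasesStubHi
  (exists_tau le_two_mul_mul_div)
open Summit.QuantumAdvantage.QuantumAdvantage.Theorems.MobiusLadderQuadraticDigitPhasesStubCompact
  (sum_range_mul_block)

/-! ### Blocks with a slowly varying weight -/

/-- ONE aligned block `[cL, cL + L)`: if `g` is `1`-bounded with block sum `≤ δ L`, `ρ₁, ρ₂` are
`1`-bounded and `u₁, u₂ : ℕ → ℕ` are monotone, then the weighted block sum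
`Σ_y ρ₁(u₁(cL+y)) ρ₂(u₂(cL+y)) g(cL+y)` is at most `δ L` plus `L` times the total jump of `u₁, u₂`
across the block (a "good" block has no jump and a constant weight; a "bad" one has jump `≥ 1`). -/
theorem norm_block_le (ρ₁ ρ₂ : ℕ → ℂ) (u₁ u₂ : ℕ → ℕ) (g : ℕ → ℂ) (L c : ℕ) {δ : ℝ}
    (hρ₁ : ∀ b, ‖ρ₁ b‖ ≤ 1) (hρ₂ : ∀ b, ‖ρ₂ b‖ ≤ 1) (hu₁ : Monotone u₁) (hu₂ : Monotone u₂)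
    (hg : ∀ m, ‖g m‖ ≤ 1) (hδ : 0 ≤ δ)
    (hblock : ‖∑ y ∈ range L, g (c * L + y)‖ ≤ δ * L) :
    ‖∑ y ∈ range L, ρ₁ (u₁ (c * L + y)) * ρ₂ (u₂ (c * L + y)) * g (c * L + y)‖ ≤
      δ * L + L * (((u₁ ((c + 1) * L) : ℝ) - u₁ (c * L)) +
        ((u₂ ((c + 1) * L) : ℝ) - u₂ (c * L))) := by
  have hcL : c * L ≤ (c + 1) * L := by nlinarith
  have hm₁ : u₁ (c * L) ≤ u₁ ((c + 1) * L) := hu₁ hcL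
  have hm₂ : u₂ (c * L) ≤ u₂ ((c + 1) * L) := hu₂ hcL
  have hm₁' : (u₁ (c * L) : ℝ) ≤ u₁ ((c + 1) * L) := by exact_mod_cast hm₁
  have hm₂' : (u₂ (c * L) : ℝ) ≤ u₂ ((c + 1) * L) := by exact_mod_cast hm₂
  have hL : (0 : ℝ) ≤ L := Nat.cast_nonneg L
  by_cases hgood : u₁ ((c + 1) * L) = u₁ (c * L) ∧ u₂ ((c + 1) * L) = u₂ (c * L)
  · -- good block: the weight `ρ₁ ρ₂` is constant on it
    have hconst : ∀ y ∈ range L, ρ₁ (u₁ (c * L + y)) * ρ₂ (u₂ (c * L + y)) * g (c * L + y) =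
        ρ₁ (u₁ (c * L)) * ρ₂ (u₂ (c * L)) * g (c * L + y) := by
      intro y hy
      have hy' : c * L + y ≤ (c + 1) * L := by rw [mem_range] at hy; nlinarith
      have h1 : u₁ (c * L + y) = u₁ (c * L) :=
        le_antisymm ((hu₁ hy').trans hgood.1.le) (hu₁ (Nat.le_add_right _ _))
      have h2 : u₂ (c * L + y) = u₂ (c * L) :=
        le_antisymm ((hu₂ hy').trans hgood.2.le) (hu₂ (Nat.le_add_right _ _))
      rw [h1, h2]
    rw [sum_congr rfl hconst, ← mul_sum, norm_mul]
    have hw : ‖ρ₁ (u₁ (c * L)) * ρ₂ (u₂ (c * L))‖ ≤ 1 := by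
      rw [norm_mul]
      exact mul_le_one₀ (hρ₁ _) (norm_nonneg _) (hρ₂ _)
    calc ‖ρ₁ (u₁ (c * L)) * ρ₂ (u₂ (c * L))‖ * ‖∑ y ∈ range L, g (c * L + y)‖
          ≤ 1 * (δ * L) := mul_le_mul hw hblock (norm_nonneg _) zero_le_one
      _ ≤ _ := by nlinarith
  · -- bad block: trivial bound `L`, and one of the jumps is `≥ 1`
    have hjump : (1 : ℝ) ≤ ((u₁ ((c + 1) * L) : ℝ) - u₁ (c * L)) +
        ((u₂ ((c + 1) * L) : ℝ) - u₂ (c * L)) := by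
      rcases not_and_or.mp hgood with h | h
      · have h' : u₁ (c * L) + 1 ≤ u₁ ((c + 1) * L) := by omega
        have h'' : (u₁ (c * L) : ℝ) + 1 ≤ u₁ ((c + 1) * L) := by exact_mod_cast h'
        linarith
      · have h' : u₂ (c * L) + 1 ≤ u₂ ((c + 1) * L) := by omega
        have h'' : (u₂ (c * L) : ℝ) + 1 ≤ u₂ ((c + 1) * L) := by exact_mod_cast h'
        linarith
    calc ‖∑ y ∈ range L, ρ₁ (u₁ (c * L + y)) * ρ₂ (u₂ (c * L + y)) * g (c * L + y)‖
          ≤ ∑ y ∈ range L, ‖ρ₁ (u₁ (c * L + y)) * ρ₂ (u₂ (c * L + y)) * g (c * L + y)‖ :=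
            norm_sum_le _ _
      _ ≤ ∑ y ∈ range L, (1 : ℝ) := sum_le_sum fun y _ => by
            rw [norm_mul, norm_mul]
            exact mul_le_one₀ (mul_le_one₀ (hρ₁ _) (norm_nonneg _) (hρ₂ _)) (norm_nonneg _) (hg _)
      _ = L := by simp
      _ ≤ _ := by nlinarith

/-- ALL blocks: summing `norm_block_le` over `c < Q`, the jumps telescope, so
`‖Σ_{m < LQ} ρ₁(u₁ m) ρ₂(u₂ m) g(m)‖ ≤ δ L Q + L · ((u₁(QL) - u₁ 0) + (u₂(QL) - u₂ 0))`. -/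
theorem norm_sum_blocks_le (ρ₁ ρ₂ : ℕ → ℂ) (u₁ u₂ : ℕ → ℕ) (g : ℕ → ℂ) (L Q : ℕ) {δ : ℝ}
    (hρ₁ : ∀ b, ‖ρ₁ b‖ ≤ 1) (hρ₂ : ∀ b, ‖ρ₂ b‖ ≤ 1) (hu₁ : Monotone u₁) (hu₂ : Monotone u₂)
    (hg : ∀ m, ‖g m‖ ≤ 1) (hδ : 0 ≤ δ)
    (hblock : ∀ c, ‖∑ y ∈ range L, g (c * L + y)‖ ≤ δ * L) :
    ‖∑ m ∈ range (L * Q), ρ₁ (u₁ m) * ρ₂ (u₂ m) * g m‖ ≤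
      δ * L * Q + L * (((u₁ (Q * L) : ℝ) - u₁ 0) + ((u₂ (Q * L) : ℝ) - u₂ 0)) := by
  rw [← sum_range_mul_block (fun m => ρ₁ (u₁ m) * ρ₂ (u₂ m) * g m) L Q]
  have hcomm : ∀ c a, L * c + a = c * L + a := fun c a => by ring
  simp only [hcomm]
  have ht₁ : ∑ c ∈ range Q, ((u₁ ((c + 1) * L) : ℝ) - u₁ (c * L)) = u₁ (Q * L) - u₁ (0 * L) :=
    Finset.sum_range_sub (fun c => (u₁ (c * L) : ℝ)) Q
  have ht₂ : ∑ c ∈ range Q, ((u₂ ((c + 1) * L) : ℝ) - u₂ (c * L)) = u₂ (Q * L) - u₂ (0 * L) :=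
    Finset.sum_range_sub (fun c => (u₂ (c * L) : ℝ)) Q
  calc ‖∑ c ∈ range Q, ∑ y ∈ range L, ρ₁ (u₁ (c * L + y)) * ρ₂ (u₂ (c * L + y)) * g (c * L + y)‖
        ≤ ∑ c ∈ range Q, ‖∑ y ∈ range L, ρ₁ (u₁ (c * L + y)) * ρ₂ (u₂ (c * L + y)) * g (c * L + y)‖ :=
          norm_sum_le _ _
    _ ≤ ∑ c ∈ range Q, (δ * L + L * (((u₁ ((c + 1) * L) : ℝ) - u₁ (c * L)) +
          ((u₂ ((c + 1) * L) : ℝ) - u₂ (c * L)))) :=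
          sum_le_sum fun c _ => norm_block_le ρ₁ ρ₂ u₁ u₂ g L c hρ₁ hρ₂ hu₁ hu₂ hg hδ (hblock c)
    _ = δ * L * Q + L * (((u₁ (Q * L) : ℝ) - u₁ 0) + ((u₂ (Q * L) : ℝ) - u₂ 0)) := by
          rw [sum_add_distrib, sum_const, card_range, ← mul_sum, sum_add_distrib, ht₁, ht₂, zero_mul,
            nsmul_eq_mul]
          ring

/-- THE PAIR SUM. For `1`-bounded `σ, f`, `0 < H`, a block length `L > 0` on which the correlations
`f(p₁ ·) conj f(p₂ ·)` have aligned block sums `≤ δ L`, and `(p₁ + p₂) L ≤ δ H`, the BSZ pair sum of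
`F(m) = σ(⌊m/H⌋) f(m)` over `1 ≤ m ≤ M` has norm `≤ 2δ(M+1) + L + 1`: the blocks inside `[0, M]`
give `δ · LQ` (good) plus `L · (p₁ + p₂) LQ / H ≤ δ · LQ` (bad, `LQ ≤ M + 1`), the incomplete last
block `≤ L`, and the removed `m = 0` term `≤ 1`. -/
theorem norm_pair_le (σ f : ℕ → ℂ) (H p₁ p₂ M L : ℕ) {δ : ℝ}
    (hσ : ∀ b, ‖σ b‖ ≤ 1) (hf : ∀ m, ‖f m‖ ≤ 1) (hδ : 0 ≤ δ) (hH : 0 < H) (hL : 0 < L)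
    (hblock : ∀ a : ℕ, ‖∑ y ∈ range L, f (p₁ * (a * L + y)) *
        starRingEnd ℂ (f (p₂ * (a * L + y)))‖ ≤ δ * L)
    (hsmall : ((p₁ : ℝ) + p₂) * L ≤ δ * H) :
    ‖∑ m ∈ Icc 1 M, σ (p₁ * m / H) * f (p₁ * m) * starRingEnd ℂ (σ (p₂ * m / H) * f (p₂ * m))‖ ≤
      2 * δ * (M + 1) + L + 1 := by
  set G : ℕ → ℂ := fun m =>
    σ (p₁ * m / H) * f (p₁ * m) * starRingEnd ℂ (σ (p₂ * m / H) * f (p₂ * m)) with hG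
  set g : ℕ → ℂ := fun m => f (p₁ * m) * starRingEnd ℂ (f (p₂ * m)) with hg
  have hGg : ∀ m, G m = σ (p₁ * m / H) * starRingEnd ℂ (σ (p₂ * m / H)) * g m := fun m => by
    simp only [hG, hg, map_mul]; ring
  have hg1 : ∀ m, ‖g m‖ ≤ 1 := fun m => by
    rw [hg, norm_mul, Complex.norm_conj]
    exact mul_le_one₀ (hf _) (norm_nonneg _) (hf _)
  have hG1 : ∀ m, ‖G m‖ ≤ 1 := fun m => by
    rw [hGg, norm_mul, norm_mul, Complex.norm_conj]
    exact mul_le_one₀ (mul_le_one₀ (hσ _) (norm_nonneg _) (hσ _)) (norm_nonneg _) (hg1 _)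
  -- Euclidean division of `M + 1` by `L`
  set Q : ℕ := (M + 1) / L
  set r : ℕ := (M + 1) % L
  have hQr : L * Q + r = M + 1 := Nat.div_add_mod (M + 1) L
  have hrL : r < L := Nat.mod_lt _ hL
  -- splitting `Σ_{1 ≤ m ≤ M} = Σ_{m < LQ} + Σ_{LQ ≤ m ≤ M} - (m = 0)`
  have hsplit : ∑ m ∈ Icc 1 M, G m =
      ∑ m ∈ range (L * Q), G m + ∑ i ∈ range r, G (L * Q + i) - G 0 := by
    have h1 : ∑ m ∈ range (M + 1), G m = G 0 + ∑ m ∈ Icc 1 M, G m := by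
      rw [Finset.sum_range_eq_add_Ico G (by omega : 0 < M + 1), Finset.Ico_add_one_right_eq_Icc]
    have h2 : ∑ m ∈ range (M + 1), G m =
        ∑ m ∈ range (L * Q), G m + ∑ i ∈ range r, G (L * Q + i) := by
      rw [← hQr, Finset.sum_range_add]
    linear_combination h1.symm.trans h2
  -- the complete blocks
  have hmono : ∀ p : ℕ, Monotone fun m : ℕ => p * m / H := fun p a b hab =>
    Nat.div_le_div_right (Nat.mul_le_mul_left p hab)
  have hmain := norm_sum_blocks_le σ (fun b => starRingEnd ℂ (σ b)) (fun m => p₁ * m / H)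
    (fun m => p₂ * m / H) g L Q hσ (fun b => by rw [Complex.norm_conj]; exact hσ b) (hmono p₁)
    (hmono p₂) hg1 hδ hblock
  simp only [mul_zero, Nat.zero_div, Nat.cast_zero, sub_zero] at hmain
  have hLQ : ((L : ℝ) * Q) ≤ M + 1 := by exact_mod_cast (show L * Q ≤ M + 1 by omega)
  have hu : ∀ p : ℕ, (L : ℝ) * ((p * (Q * L) / H : ℕ) : ℝ) ≤ p * L / H * (L * Q) := by
    intro p
    calc (L : ℝ) * ((p * (Q * L) / H : ℕ) : ℝ) ≤ L * (((p * (Q * L) : ℕ) : ℝ) / H) := by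
          gcongr; exact Nat.cast_div_le
      _ = p * L / H * (L * Q) := by push_cast; ring
  have hsmall' : (p₁ : ℝ) * L / H + p₂ * L / H ≤ δ := by
    rw [← add_div, div_le_iff₀ (by exact_mod_cast hH : (0 : ℝ) < H)]
    linarith [hsmall]
  have hblocks : ‖∑ m ∈ range (L * Q), G m‖ ≤ 2 * δ * (M + 1) := by
    simp only [hGg]
    calc _ ≤ _ := hmain
      _ ≤ δ * (L * Q) + ((p₁ : ℝ) * L / H + p₂ * L / H) * (L * Q) := by nlinarith [hu p₁, hu p₂]
      _ ≤ δ * (M + 1) + δ * (M + 1) := by gcongr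
      _ = 2 * δ * (M + 1) := by ring
  -- the incomplete last block and the `m = 0` term
  have htail : ‖∑ i ∈ range r, G (L * Q + i)‖ ≤ L := by
    calc ‖∑ i ∈ range r, G (L * Q + i)‖ ≤ ∑ i ∈ range r, ‖G (L * Q + i)‖ := norm_sum_le _ _
      _ ≤ ∑ i ∈ range r, (1 : ℝ) := sum_le_sum fun i _ => hG1 _
      _ = r := by simp
      _ ≤ L := by exact_mod_cast hrL.le
  rw [hsplit]
  calc ‖∑ m ∈ range (L * Q), G m + ∑ i ∈ range r, G (L * Q + i) - G 0‖
        ≤ ‖∑ m ∈ range (L * Q), G m‖ + ‖∑ i ∈ range r, G (L * Q + i)‖ + ‖G 0‖ :=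
          (norm_sub_le _ _).trans (by gcongr; exact norm_add_le _ _)
    _ ≤ 2 * δ * (M + 1) + L + 1 := add_le_add_three hblocks htail (hG1 0)

/-- Polar duality for one complex number: `(conj z / ‖z‖) · z = ‖z‖` (both sides `0` at `z = 0`). -/
theorem conj_div_norm_mul_self (z : ℂ) : starRingEnd ℂ z / (‖z‖ : ℂ) * z = (‖z‖ : ℂ) := by
  rcases eq_or_ne z 0 with rfl | hz
  · simp
  · have h : (‖z‖ : ℂ) ≠ 0 := by exact_mod_cast (norm_ne_zero_iff.mpr hz)
    rw [div_mul_eq_mul_div, Complex.conj_mul', sq, mul_div_assoc, div_self h, mul_one]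

/-- The sign `conj z / ‖z‖` has norm `≤ 1`. -/
theorem norm_conj_div_norm_le (z : ℂ) : ‖starRingEnd ℂ z / (‖z‖ : ℂ)‖ ≤ 1 := by
  rw [norm_div, Complex.norm_conj, Complex.norm_real, Real.norm_eq_abs, abs_norm]
  exact div_self_le_one _

/-- DUALITY. For `k ≤ n` there are signs `σ : ℕ → ℂ` of norm `≤ 1` (namely `σ(b) = conj(S_b)/‖S_b‖`,
`S_b` the `b`-th block sum) such that the block statistic
`Σ_{b<2^{n-k}} ‖Σ_{a<2^k} λ(2^k b + a) f(2^k b + a)‖`, cast to `ℂ`, equals the single correlation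
`Σ_{1 ≤ m ≤ 2^n - 1} λ(m) σ(⌊m/2^k⌋) f(m)` (the `m = 0` term vanishes as `λ 0 = 0`). -/
theorem duality (f : ℕ → ℂ) {k n : ℕ} (hkn : k ≤ n) :
    ∃ σ : ℕ → ℂ, (∀ b, ‖σ b‖ ≤ 1) ∧
      (((∑ b ∈ range (2 ^ (n - k)), ‖∑ a ∈ range (2 ^ k),
          ((ArithmeticFunction.liouville (2 ^ k * b + a) : ℤ) : ℂ) * f (2 ^ k * b + a)‖ : ℝ) : ℂ) =
        ∑ m ∈ Icc 1 (2 ^ n - 1),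
          (ArithmeticFunction.liouville : ArithmeticFunction ℂ) m * (σ (m / 2 ^ k) * f m)) := by
  set S : ℕ → ℂ := fun b => ∑ a ∈ range (2 ^ k),
    ((ArithmeticFunction.liouville (2 ^ k * b + a) : ℤ) : ℂ) * f (2 ^ k * b + a) with hS
  refine ⟨fun b => starRingEnd ℂ (S b) / (‖S b‖ : ℂ), fun b => norm_conj_div_norm_le (S b), ?_⟩
  have hH : 0 < 2 ^ k := Nat.two_pow_pos k
  -- one block: `‖S b‖ = Σ_{a < H} λ(Hb+a) σ(⌊(Hb+a)/H⌋) f(Hb+a)`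
  have hblock : ∀ b : ℕ, ((‖S b‖ : ℝ) : ℂ) = ∑ a ∈ range (2 ^ k),
      (ArithmeticFunction.liouville : ArithmeticFunction ℂ) (2 ^ k * b + a) *
        (starRingEnd ℂ (S ((2 ^ k * b + a) / 2 ^ k)) / (‖S ((2 ^ k * b + a) / 2 ^ k)‖ : ℂ) *
          f (2 ^ k * b + a)) := by
    intro b
    have hdiv : ∀ a ∈ range (2 ^ k), (2 ^ k * b + a) / 2 ^ k = b := fun a ha => by
      rw [Nat.mul_add_div hH, Nat.div_eq_of_lt (mem_range.mp ha), add_zero]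
    rw [sum_congr rfl fun a ha => by rw [hdiv a ha]]
    calc ((‖S b‖ : ℝ) : ℂ) = starRingEnd ℂ (S b) / (‖S b‖ : ℂ) * S b :=
          (conj_div_norm_mul_self (S b)).symm
      _ = starRingEnd ℂ (S b) / (‖S b‖ : ℂ) * ∑ a ∈ range (2 ^ k),
            ((ArithmeticFunction.liouville (2 ^ k * b + a) : ℤ) : ℂ) * f (2 ^ k * b + a) := rfl
      _ = _ := by
          rw [mul_sum]
          refine sum_congr rfl fun a _ => ?_
          rw [ArithmeticFunction.intCoe_apply]
          ring
  have h2n : 2 ^ k * 2 ^ (n - k) = 2 ^ n := by rw [← pow_add, Nat.add_sub_cancel' hkn]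
  have hsub : Icc 1 (2 ^ n - 1) ⊆ range (2 ^ n) := fun m hm => by
    rw [mem_Icc] at hm; rw [mem_range]; omega
  push_cast
  rw [sum_congr rfl fun b _ => hblock b, sum_range_mul_block (fun m =>
    (ArithmeticFunction.liouville : ArithmeticFunction ℂ) m *
      (starRingEnd ℂ (S (m / 2 ^ k)) / (‖S (m / 2 ^ k)‖ : ℂ) * f m)) (2 ^ k) (2 ^ (n - k)), h2n]
  symm
  apply Finset.sum_subset hsub
  intro m hm hm'
  have hm0 : m = 0 := by rw [mem_range] at hm; rw [mem_Icc] at hm'; omega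
  subst hm0
  simp [ArithmeticFunction.map_zero]

/-- The block-control hypothesis, made uniform over all pairs of distinct odd primes `≤ B` (finitely
many pairs, `Filter.eventually_all_finset`). -/
theorem exists_uniform_blocks (f : ℕ → ℂ) {δ : ℝ} (hδ : 0 < δ) (B : ℕ)
    (hf : ∀ p₁ p₂ : ℕ, p₁.Prime → p₂.Prime → p₁ ≠ p₂ → 2 < p₁ → 2 < p₂ →
        ∀ δ : ℝ, 0 < δ → ∃ l₀ : ℕ, ∀ l : ℕ, l₀ ≤ l → ∀ a : ℕ,
          ‖∑ y ∈ range (2 ^ l), f (p₁ * (a * 2 ^ l + y)) * starRingEnd ℂ (f (p₂ * (a * 2 ^ l + y)))‖ ≤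
            δ * (2 : ℝ) ^ l) :
    ∃ l₀ : ℕ, ∀ l : ℕ, l₀ ≤ l → ∀ p₁ p₂ : ℕ, p₁ ≤ B → p₂ ≤ B → p₁.Prime → p₂.Prime → p₁ ≠ p₂ →
      2 < p₁ → 2 < p₂ → ∀ a : ℕ,
        ‖∑ y ∈ range (2 ^ l), f (p₁ * (a * 2 ^ l + y)) * starRingEnd ℂ (f (p₂ * (a * 2 ^ l + y)))‖ ≤
          δ * (2 : ℝ) ^ l := by
  have hev : ∀ᶠ l : ℕ in atTop, ∀ q ∈ range (B + 1) ×ˢ range (B + 1),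
      q.1.Prime → q.2.Prime → q.1 ≠ q.2 → 2 < q.1 → 2 < q.2 → ∀ a : ℕ,
        ‖∑ y ∈ range (2 ^ l), f (q.1 * (a * 2 ^ l + y)) *
          starRingEnd ℂ (f (q.2 * (a * 2 ^ l + y)))‖ ≤ δ * (2 : ℝ) ^ l := by
    rw [Filter.eventually_all_finset]
    intro q _
    by_cases h : q.1.Prime ∧ q.2.Prime ∧ q.1 ≠ q.2 ∧ 2 < q.1 ∧ 2 < q.2
    · obtain ⟨l₀, hl₀⟩ := hf q.1 q.2 h.1 h.2.1 h.2.2.1 h.2.2.2.1 h.2.2.2.2 δ hδ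
      exact Filter.eventually_atTop.2 ⟨l₀, fun l hl _ _ _ _ _ => hl₀ l hl⟩
    · exact Filter.Eventually.of_forall fun l h1 h2 h3 h4 h5 => absurd ⟨h1, h2, h3, h4, h5⟩ h
  obtain ⟨l₀, hl₀⟩ := Filter.eventually_atTop.1 hev
  refine ⟨l₀, fun l hl p₁ p₂ hp₁B hp₂B hp₁ hp₂ hne h₁ h₂ => hl₀ l hl (p₁, p₂) ?_ hp₁ hp₂ hne h₁ h₂⟩
  rw [Finset.mem_product, mem_range, mem_range]
  omega

/-! ### The stub -/

/-- **Stub `stub_momoKatai` (banded branch of the crux `QuadraticDigitPhases`, line `Sketch`).**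
Given the Bourgain–Sarnak–Ziegler criterion at a fixed length with an `F`-independent threshold
(`hBSZ`, neighbour stub `stub_bszFixedN`): if `f : ℕ → ℂ` is `1`-bounded and, for all distinct odd
primes `p₁, p₂` and every `δ > 0`, the correlations `f(p₁ m) conj f(p₂ m)` have sums `≤ δ 2^l` on every
aligned block `[a 2^l, (a+1) 2^l)` once `l ≥ l₀(p₁, p₂, δ)`, then the dyadic block statistic
`Σ_{b < 2^{n-k}} ‖Σ_{a < 2^k} λ(2^k b + a) f(2^k b + a)‖` is `≤ ε 2^n` eventually (`k → ∞`, then `n → ∞`).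
Proof: `τ` from `StubHi.exists_tau`, `N₀` from `hBSZ`, `B = ⌈e^{1/τ}⌉`, `δ = τ/4`, a uniform block
threshold `l₀` over the prime pairs `≤ B` (`exists_uniform_blocks`), `2^c ≥ 2B/δ`; for `k ≥ l₀ + c` and
`n` large, `duality` turns the statistic into `‖Σ_{m ≤ 2^n-1} λ(m) σ(⌊m/2^k⌋) f(m)‖`, and `hBSZ`
applies because `norm_pair_le` (block length `2^{k-c}`) bounds its pair sums by `τ M`. -/
theorem stub_momoKatai
    (hBSZ : ∃ τ₀ : ℝ, 0 < τ₀ ∧ ∀ τ : ℝ, 0 < τ → τ ≤ τ₀ → ∃ N₀ : ℕ, ∀ N : ℕ, N₀ ≤ N →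
      ∀ (F : ℕ → ℂ) (ν : ArithmeticFunction ℂ),
        (∀ m, ‖F m‖ ≤ 1) → ν.IsMultiplicative → (∀ m, ‖ν m‖ ≤ 1) →
        (∀ p₁ p₂ : ℕ, p₁.Prime → p₂.Prime → p₁ ≠ p₂ →
            1 / τ < (p₁ : ℝ) → (p₁ : ℝ) ≤ Real.exp (1 / τ) →
            1 / τ < (p₂ : ℝ) → (p₂ : ℝ) ≤ Real.exp (1 / τ) →
            ‖∑ m ∈ Icc 1 (N / max p₁ p₂), F (p₁ * m) * starRingEnd ℂ (F (p₂ * m))‖ ≤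
              τ * ((N / max p₁ p₂ : ℕ) : ℝ)) →
        ‖∑ m ∈ Icc 1 N, ν m * F m‖ ≤ 2 * Real.sqrt (τ * Real.log (1 / τ)) * N) :
    ∀ f : ℕ → ℂ, (∀ m, ‖f m‖ ≤ 1) →
      (∀ p₁ p₂ : ℕ, p₁.Prime → p₂.Prime → p₁ ≠ p₂ → 2 < p₁ → 2 < p₂ →
        ∀ δ : ℝ, 0 < δ → ∃ l₀ : ℕ, ∀ l : ℕ, l₀ ≤ l → ∀ a : ℕ,
          ‖∑ y ∈ range (2 ^ l), f (p₁ * (a * 2 ^ l + y)) * starRingEnd ℂ (f (p₂ * (a * 2 ^ l + y)))‖ ≤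
            δ * (2 : ℝ) ^ l) →
      ∀ ε : ℝ, 0 < ε → ∀ᶠ k : ℕ in atTop, ∀ᶠ n : ℕ in atTop,
        ∑ b ∈ range (2 ^ (n - k)),
          ‖∑ a ∈ range (2 ^ k), ((ArithmeticFunction.liouville (2 ^ k * b + a) : ℤ) : ℂ) *
            f (2 ^ k * b + a)‖ ≤ ε * (2 : ℝ) ^ n := by
  intro f hf hblk ε hε
  obtain ⟨τ₀, hτ₀, hBSZ⟩ := hBSZ
  obtain ⟨τ, hτ, hττ₀, hτhalf, hτε⟩ := exists_tau ε τ₀ hε hτ₀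
  obtain ⟨N₀, hN₀⟩ := hBSZ τ hτ hττ₀
  obtain ⟨B, hB⟩ : ∃ B : ℕ, Real.exp (1 / τ) ≤ B := ⟨_, Nat.le_ceil _⟩
  have hB0 : (0 : ℝ) < B := (Real.exp_pos _).trans_le hB
  set δ : ℝ := τ / 4 with hδ_def
  have hδ : 0 < δ := by positivity
  obtain ⟨l₀, hl₀⟩ := exists_uniform_blocks f hδ B hblk
  obtain ⟨c, hc⟩ : ∃ c : ℕ, (2 * B : ℝ) ≤ δ * 2 ^ c := by
    refine ⟨⌈2 * B / δ⌉₊, ?_⟩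
    have h1 : (2 * B : ℝ) / δ ≤ ⌈2 * B / δ⌉₊ := Nat.le_ceil _
    have h2 : (⌈(2 * B : ℝ) / δ⌉₊ : ℝ) ≤ (2 : ℝ) ^ ⌈(2 * B : ℝ) / δ⌉₊ := by
      exact_mod_cast Nat.lt_two_pow_self.le
    rw [div_le_iff₀ hδ] at h1
    nlinarith
  have hτinv : (2 : ℝ) ≤ 1 / τ := by
    rw [le_div_iff₀ hτ]
    linarith
  refine Filter.eventually_atTop.2 ⟨l₀ + c, fun k hk => ?_⟩
  -- block length `2^l`, `l = k - c`
  obtain ⟨l, hl, rfl⟩ : ∃ l, l₀ ≤ l ∧ c + l = k := ⟨k - c, by omega, by omega⟩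
  refine Filter.eventually_atTop.2
    ⟨N₀ + 2 * B + 2 + (c + l) + ⌈(4 * B * (2 ^ l + 2) : ℝ) / τ⌉₊, fun n hn => ?_⟩
  have h2n : n < 2 ^ n := Nat.lt_two_pow_self
  have hkn : c + l ≤ n := by omega
  have hK : N₀ ≤ 2 ^ n - 1 := by omega
  have hXB : 2 * B + 2 ≤ 2 ^ n := by omega
  have hT : (4 * B * (2 ^ l + 2) : ℝ) ≤ τ * 2 ^ n := by
    have h1 : (4 * B * (2 ^ l + 2) : ℝ) / τ ≤ ⌈(4 * B * (2 ^ l + 2) : ℝ) / τ⌉₊ := Nat.le_ceil _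
    have h2 : (⌈(4 * B * (2 ^ l + 2) : ℝ) / τ⌉₊ : ℝ) ≤ (2 : ℝ) ^ n := by
      exact_mod_cast (show ⌈(4 * B * (2 ^ l + 2) : ℝ) / τ⌉₊ ≤ 2 ^ n by omega)
    rw [div_le_iff₀ hτ] at h1
    calc (4 * B * (2 ^ l + 2) : ℝ) ≤ ⌈(4 * B * (2 ^ l + 2) : ℝ) / τ⌉₊ * τ := h1
      _ ≤ (2 : ℝ) ^ n * τ := mul_le_mul_of_nonneg_right h2 hτ.le
      _ = τ * 2 ^ n := mul_comm _ _
  -- duality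
  obtain ⟨σ, hσ, hdual⟩ := duality f hkn
  -- BSZ at `N = 2^n - 1` for `F(m) = σ(⌊m/2^k⌋) f(m)` and `ν = λ`
  have hmain := hN₀ (2 ^ n - 1) hK (fun m => σ (m / 2 ^ (c + l)) * f m)
    (ArithmeticFunction.liouville : ArithmeticFunction ℂ)
    (fun m => by rw [norm_mul]; exact mul_le_one₀ (hσ _) (norm_nonneg _) (hf m))
    isMultiplicative_liouville_complex norm_liouville_complex_le_one (by
      intro p₁ p₂ hp₁ hp₂ hne h1l h1u h2l h2u
      have hp₁2 : 2 < p₁ := by exact_mod_cast (show (2 : ℝ) < p₁ by linarith)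
      have hp₂2 : 2 < p₂ := by exact_mod_cast (show (2 : ℝ) < p₂ by linarith)
      have hp₁B : p₁ ≤ B := by exact_mod_cast (show (p₁ : ℝ) ≤ B from h1u.trans hB)
      have hp₂B : p₂ ≤ B := by exact_mod_cast (show (p₂ : ℝ) ≤ B from h2u.trans hB)
      have hqB : max p₁ p₂ ≤ B := max_le hp₁B hp₂B
      have hqpos : 0 < max p₁ p₂ := lt_max_of_lt_left (by omega)
      set M : ℕ := (2 ^ n - 1) / max p₁ p₂
      have hM2 : 2 ^ n ≤ 2 * B * M := le_two_mul_mul_div (2 ^ n) B (max p₁ p₂) hqpos hqB hXB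
      have hM2' : (2 : ℝ) ^ n ≤ 2 * B * M := by exact_mod_cast hM2
      -- the block hypothesis at length `2^l` for this pair, and `(p₁ + p₂) 2^l ≤ δ 2^k`
      have hLcast : ((2 ^ l : ℕ) : ℝ) = (2 : ℝ) ^ l := by norm_num
      have hblock : ∀ a : ℕ, ‖∑ y ∈ range (2 ^ l), f (p₁ * (a * 2 ^ l + y)) *
          starRingEnd ℂ (f (p₂ * (a * 2 ^ l + y)))‖ ≤ δ * ((2 ^ l : ℕ) : ℝ) := fun a => by
        rw [hLcast]; exact hl₀ l hl p₁ p₂ hp₁B hp₂B hp₁ hp₂ hne hp₁2 hp₂2 a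
      have hsmall : ((p₁ : ℝ) + p₂) * ((2 ^ l : ℕ) : ℝ) ≤ δ * ((2 ^ (c + l) : ℕ) : ℝ) := by
        have hpp : ((p₁ : ℝ) + p₂) ≤ 2 * B := by
          linarith [(Nat.cast_le (α := ℝ)).mpr hp₁B, (Nat.cast_le (α := ℝ)).mpr hp₂B]
        rw [hLcast]
        push_cast
        rw [pow_add]
        calc ((p₁ : ℝ) + p₂) * (2 : ℝ) ^ l ≤ (2 * B) * (2 : ℝ) ^ l := by gcongr
          _ ≤ (δ * 2 ^ c) * (2 : ℝ) ^ l := by gcongr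
          _ = δ * (2 ^ c * 2 ^ l) := by ring
      have hpair := norm_pair_le σ f (2 ^ (c + l)) p₁ p₂ M (2 ^ l) hσ hf hδ.le (Nat.two_pow_pos _)
        (Nat.two_pow_pos _) hblock hsmall
      refine hpair.trans ?_
      rw [hLcast]
      -- `2δ(M+1) + 2^l + 1 ≤ τ M` from `4B(2^l+2) ≤ τ 2^n ≤ 2BτM`
      have e1 : (4 * B * (2 ^ l + 2) : ℝ) ≤ 2 * B * (τ * M) := by nlinarith
      have e2 : (2 * (2 ^ l + 2) : ℝ) ≤ τ * M := by nlinarith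
      rw [hδ_def]
      nlinarith)
  -- conclusion
  have hnn : (0 : ℝ) ≤ ∑ b ∈ range (2 ^ (n - (c + l))), ‖∑ a ∈ range (2 ^ (c + l)),
      ((ArithmeticFunction.liouville (2 ^ (c + l) * b + a) : ℤ) : ℂ) * f (2 ^ (c + l) * b + a)‖ :=
    sum_nonneg fun b _ => norm_nonneg _
  rw [← abs_of_nonneg hnn, ← Real.norm_eq_abs, ← Complex.norm_real, hdual]
  refine hmain.trans ?_
  have hcast : ((2 ^ n - 1 : ℕ) : ℝ) ≤ (2 : ℝ) ^ n := by exact_mod_cast Nat.sub_le (2 ^ n) 1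
  have h2pos : (0 : ℝ) < (2 : ℝ) ^ n := by positivity
  calc 2 * Real.sqrt (τ * Real.log (1 / τ)) * ((2 ^ n - 1 : ℕ) : ℝ)
        ≤ (ε / 2) * (2 : ℝ) ^ n := mul_le_mul hτε hcast (by positivity) (by positivity)
    _ ≤ ε * (2 : ℝ) ^ n := by nlinarith

end Summit.QuantumAdvantage.QuantumAdvantage.Theorems.MobiusLadderQuadraticDigitPhasesStubMomoKatai
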